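import Summits.QuantumFields.YangMills.Theorems.BalabanUVNodesN19RateEdgeHolder
import Summits.QuantumFields.YangMills.Theorems.BalabanUVNodesN19InEdgesAlongRuns

/-!
# BalabanUVNodes ∕ N19 — E's BY-NAME N19′ RATE EDGE IN THE R-β CURRENCY WITH (v′-17)'s β-WINDOW LETTER READ ALONG THE RUNS: `EventualLowerH bβ R.u3.γ k₀β D.βfun`
# (a lower β-bound on the whole γ-box; UNPRINTED, T09.F) replaced by `∀ K m, k₀β ≤ m → m < K → bβ ≤ D.βfun m (g^{(K)}_0, …, g^{(K)}_m)` — the bound along the link reading's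
# own runs, which is what the knit actually reads — and the runs' box ∕ the smallness window read at the runs' OWN radius `γt ≤ R.u3.γ`

Cell `pub-ymgap`, HUMAN RULING D-0062 (Track A) + D-0149 (work-bound push, director-ym №197), WIDTH SEAT `pub-ymgap-dag-n19-w3` (N19 NE7, seat 3 of 3), generation g2;
bus INTENT-6.  Cluster item K3⁷ «SpineGivenEndpointR13SepCoPH» (stmt-QuantumFields-20544); filed `--kind proof --supports` that item `--as helper` (it proves no registered
stub).  COUNT-NEUTRAL.  THEOREMS ONLY; 0 `def`; 0 `sorry`; NO Theses import.

PROVENANCE.  -- adapted from `Summits/QuantumFields/YangMills/Theorems/BalabanUVNodesN19RateEdgeHolder.lean` (dag-n19-d g22's E, p582895; itself v9 p475545 token for token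
with four changes): statement and proof are E's TOKEN FOR TOKEN with exactly THREE changes — (1) inside clause (v′-17) of the link reading the conjunct
`EventualLowerH bβ R.u3.γ k₀β D.βfun` becomes `(∀ K m, k₀β ≤ m → m < K → bβ ≤ D.βfun m (prefixOf (g K) m))` (the lower β-bound ALONG THE READING's OWN RUNS `g K`, from
scale `k₀β` on); (2) a radius letter `γt` with `0 < γt ∧ γt ≤ R.u3.γ` is added, the runs' box is read at `γt` (`g K i ≤ γt`, implying E's box at `R.u3.γ`) and the
smallness window at `γt`: `R.u3.cr·R.u3.C₉·R.u3.ω·((k₀β+1)γt³ + 2γt∕bβ) ≤ (1−R.u3.ρ)∕2` (WEAKER than E's at `R.u3.γ`; E's shape is the case `γt := R.u3.γ`); (3) the proof reads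
node U2's output through this seat's `N19InEdgesAlongRuns.injectedRate_of_n17At_readOutAt_along_radius` (INTENT-5) at the place of dag-n19-a's
`N19InEdgesAtRecord.injectedRate_of_n17At_readOutAt`.  Everything else — `PRec`, `hβ1`, (i), (ii-m), (iii), (iv), (ii-v-A∕B), (ii-d), (v′-16), the rest of (v′-17), (T) in
the tube currency, the windows, and the knit — is BYTE-IDENTICAL to E.  E, v9, dag-n19-a's p421499∕p429658 and dag-n16-c's file 18 are CITED BY
NAME (E imported) and not edited.

WHY (numbers, not adjectives).  The box-form letter is consumed ONLY through `T4CouplingMatching.inv_sq_lower_of_eventualLower`, which evaluates it at `prefixOf (g K) m` and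
`prefixOf (g (K+1)) m` (l.693–695) — along the two runs; INTENT-5 re-ran that chain with the hypothesis read there.  The along-the-runs letter is STRICTLY WEAKER than
`EventualLowerH` (`prefixOf_mem_box`), so this edge has a WEAKER link reading than E; and for the runs of record of a TUNED bare sequence it is the lower half of K1⁷'s
interval-form window `BetaBoundsInInterval D.C.toB12 γ₀ b b′` (INTENT-5 `alongLower_runFlow_of_tuned`, `k₀β := 0`) — which the box form is NOT (a box history need not be
a trajectory of the forward-generated datum); and the runs of a bare sequence tuned within `]0, γ]` live in the γ-box, so `γt := γ` makes the smallness window a condition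
at the TUNING radius.  Consumer: this seat's AtRuns face re-issued over this edge (INTENT-7) discharges `0 < bβ ∧ EventualLowerH …` from K1⁷'s window (the binder that
already discharges (T)'s upper running there) and displays the smallness window at the tuning radius.

HONEST FRAMING.  Count-neutral kernel bookkeeping; NE7 ∕ NE3 ∕ N16 ∕ N07 NOT PRINTED as two-run statements and NOT proved (`h16`'s `CovRootHolder`, `LeafH3sup`, the
selection, the readings, `hdomC1`, every (T) input are HYPOTHESES inside `hlink`); `PRec` is a PARAMETER (no carrier of record is instantiated here); nothing of
Bałaban's is asserted; N19 NOT discharged; K3⁷ NOT claimed; Track A count unmoved (5∕27 · A 5∕28).  One finite four-torus at fixed ε, rung (B)+1 — R4 closes the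
CONDITIONAL finite-𝕋⁴ rung `BalabanLadder.UV` only; NOT infinite volume, NOT OS on ℝ⁴, NOT a mass gap; the YM mass gap (Clay) is NOT proved by any of this.  Standard axioms.
Supersedes nothing; edits nothing.
-/

set_option autoImplicit false

noncomputable section

open Finset MeasureTheory
open scoped BigOperators Matrix Matrix.Norms.L2Operator

namespace Summit.QuantumFields.YangMills.BalabanUVNodes.N19RateEdgeHolderAlong

open Literature.MathematicalPhysics.QuantumFieldTheory.Balaban1983to89
open T4OutputRate T4RecentScale T4GoodClassBudget T4CauchySum T4TowerRateComposition T4TowerRateDischarge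
open T4EtaRateMin (Readings NE3Shape)
open T4RateLiaison (GaugeDominated)
open T4CouplingMatching (EventualLowerH)
open FlowStep (RGEqH)
open TreeLengthTorus (TFaceConnected torusTreeLen)
open B12TreeDecay (kappa₀)
open Summit.QuantumFields.BalabanUV.T4Continuum
open AveragingDeficitDualResidual (dualC1 dualC2)
open AveragingDeficitDerivWallProof (wallConst)
open AveragingDeficitPeriodicCounting (IsPeriodicDir)
open MinimalActionSandwich (IsMinimiser minAct)
open MinimalActionRate (sfClass)
open MinimalActionRefine (RegularSup gradConst)
open NE3EnergyShapes (IsUnitarySite IsPeriodicSite)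
open NE3.LeafIndexSockets (LeafH3sup)
open Summit.QuantumFields.BalabanUV.T4Continuum.Spine
open Summit.QuantumFields.BalabanUV.T4Continuum.NE1p.DressedRoot (DressedTower DressedStabilityStrict)
open Summit.QuantumFields.YangMills.BalabanUVNodes.N19LedgerLinkSync (LedgerDataSync LedgerAtSync core_summable_of_ledgerAtSync)
open Summit.QuantumFields.YangMills.BalabanUVNodes.N19MultiplicityByName (core_summable_of_ledgerAtSync_multByName)
open Summit.QuantumFields.YangMills.BalabanUVNodes.N19RateEdge (ne5_of_n18At dressedStabilityStrict_of_n14At)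
open Summit.QuantumFields.YangMills.BalabanUVNodes.N19InEdgesAtRecord (ledgerAtSync_withLoc ne3Liaison_of_covRoot injectedRate_of_n17At_readOutAt)
open Summit.QuantumFields.YangMills.BalabanUVNodes.N19InEdgesAlongRuns (injectedRate_of_n17At_readOutAt_along_radius)
open FlowStep (prefixOf)
open Summit.QuantumFields.YangMills.BalabanUVNodes.N19LipBracketTube (lipBracket_of_pairDisc lipBracket_at_rateCarriers_of_pairDisc)
open YMDAG.UVSplit (SpineCarriers SpineRecordPred InputsPred U3Carriers RateCarriers RateRecordPred N14At N18At N22At ReadOutAt)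
open Summit.QuantumFields.YangMills.BalabanUVNodes.N16HolderDefs (CovRootHolder N16HolderAt)
open Summit.QuantumFields.YangMills.BalabanUVNodes.SpineRatesHolder (RatesHolderAt)
open Summit.QuantumFields.YangMills.BalabanUVNodes.N19LiaisonC1Holder (ne3LiaisonC1_of_covRootHolder)


/-! ## §1 E's by-name link reading at the two carrier records in the R-β currency, the β-window letter read ALONG THE RUNS -/

section Edge

variable {N : ℕ} [NeZero N]

/-- **THE N19′ RATE EDGE AT THE TWO CARRIER RECORDS IN THE R-β CURRENCY, THE β-WINDOW LETTER ALONG THE RUNS** [bookkeeping].  IDENTICAL to dag-n19-d's E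
`N19RateEdgeHolder.rateEdge_of_linkReading_byName_pairDiscC1Holder` EXCEPT: inside clause (v′-17) the conjunct `EventualLowerH bβ R.u3.γ k₀β D.βfun` is replaced by the
lower bound along the reading's own runs `∀ K m, k₀β ≤ m → m < K → bβ ≤ D.βfun m (prefixOf (g K) m)` (STRICTLY WEAKER: `prefixOf_mem_box`), the runs' box and the
smallness window are read at a radius letter `0 < γt ≤ R.u3.γ`, and the proof reads node U2's output through `N19InEdgesAlongRuns.injectedRate_of_n17At_readOutAt_along_radius`.
Everything else verbatim.  NOT NE7; N19 NOT discharged; `hlink` is NODE O's world, DISPLAYED. [folklore] -/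
theorem rateEdge_of_linkReadingAlong_byName_pairDiscC1Holder
    (PRec : (F : T4Continuum.T4Family) → YMDAG.UVSplit.Datum F N → (ℕ → ℝ) → List (T4Continuum.ULoop F) → SpineCarriers → RateCarriers N → Prop)
    {β : ℝ} (hβ1 : β ≤ 1)
    (hlink : ∀ (F : T4Continuum.T4Family) (D : YMDAG.UVSplit.Datum F N) (g₀ : ℕ → ℝ) (os : List (T4Continuum.ULoop F))
      (S : SpineCarriers) (R : RateCarriers N), PRec F D g₀ os S R → letI := S.dec
      ∃ (_ : DecidableEq R.u3.C.Dom) (F' : Type) (ι' X' : Type) (_ : MeasurableSpace ι')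
        (L : LedgerDataSync R.u3.C F' ι' S.ι) (Rd : Readings ι' X') (bsel : (ℕ → ℝ) → ℝ) (EB : Functional R.u3.C R.u3.C.BgB)
        (θc θ₃ : ℝ) (g : ℕ → ℕ → ℝ)
        (uA : ℕ → ι' → R.u3.C.BgA) (uB : ℕ → ι' → R.u3.C.BgB)
        (Pf : ℕ → Params) (d₀ L₀ Koff : ℕ) (cells : (K j : ℕ) → R.u3.C.Dom → Finset (Site (Pf K) j))
        (H033 : Flow → ℕ → Prop) (I : Type) (fam : I → B14.Sect2Data) (Lb βw : ℝ) (κ₁ : ℕ) (Gv Cl : ℝ) (K₁ : ℕ)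
        (Λ₀ N₀ : ℝ) (dressed : R.u3.C.Dom → Prop) (_ : DecidablePred dressed)
        -- N16-side letters: regime, selection, reading map, NE7 route-#1 side letters, offset
        (c' t ε₁ θ γ₃ l₁ : ℝ)
        (sel : ℕ → (B7Prop1Explicit.Site 4 → Fin 4 → (Matrix (Fin N) (Fin N) ℂ)ˣ) → (B7Prop1Explicit.Site 4 → Fin 4 → (Matrix (Fin N) (Fin N) ℂ)ˣ))
        (rd : ι' → (B7Prop1Explicit.Site 4 → Fin 4 → (Matrix (Fin N) (Fin N) ℂ)ˣ)) (k₀ : ℕ)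
        -- N17-side letters: infrared pin, β-window, the runs' OWN radius `γt`
        (gIR bβ γt : ℝ) (k₀β : ℕ)
        -- TUBE letters of the bracket (T): the (1.18) constant, the layer factor and (2.28)'s `C₁, q₁`, the flow's `β′`
        (E₀T κ₁T C₁T β'T : ℝ) (q₁ : ℕ),
        -- the run-B functional is the first-coupling family read through the selector
        EB = (fun s => R.u3.EB (bsel s) s) ∧
        -- (i) the ledger predicate for whatever size data and census constants meet their clauses
        (∀ (Sz : ℕ → ℝ → S.ι → ℕ → ℝ) (E₀ : ℝ) (m : ℕ) (a : ℝ) (Cw Λg : ℝ),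
          (∀ K t, |t| ≤ S.l₀ → ∀ τ ∈ S.T K \ S.Bad K t, ∀ v ∈ Rd.dom, ∀ j ≤ K,
            |∑ X ∈ L.fac K t τ with R.u3.C.scale X = j,
                (Real.log (Real.exp (EB (fun i => g (K + 1) (i + 1)) (uB K v) X
                    - EB (fun i => g (K + 1) (i + 1)) L.oneB X))
                  - Real.log (Real.exp (R.u3.EA (g K) (uA K v) X - R.u3.EA (g K) L.oneA X)))| ≤ Sz K t τ j) →
          0 ≤ E₀ → 0 < a → a < 1 →
          (∀ K t, |t| ≤ S.l₀ → ∀ τ ∈ S.T K \ S.Bad K t, ∀ j ≤ K,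
            Sz K t τ j ≤ S.vol * (E₀ * ((K : ℝ) + 1) ^ m * a ^ (K - j))) →
          (∀ K, Multiplicity (L.All K) R.u3.C.scale (fun X => Real.exp (-(R.u3.κ * R.u3.C.d X))) Cw S.vol Λg K) →
          (∀ K t, |t| ≤ S.l₀ → ∀ τ ∈ S.T K \ S.Bad K t,
            WindowMultiplicity (L.facO K t τ) L.scO L.wO Cw S.vol Λg (jlogOf L.Cl K) K) →
          1 ≤ Λg → L.θ' ≤ Λg →
          LedgerAtSync { L with S := Sz, E₀ := E₀, m := m, a := a, Cw := Cw, Λg := Λg } S.l₀ S.vol S.T S.Bad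
            (fun K t τ => S.A K t τ - S.shA K t τ) (fun K t τ => S.B K t τ - S.shB K t τ) Rd R.u3.EA EB R.u3.κ g uA uB
            R.u3.ω θc R.u3.θ θ₃) ∧
        0 ≤ S.vol ∧
        (∀ K t, |t| ≤ S.l₀ → ∀ τ ∈ S.T K \ S.Bad K t,
          WindowMultiplicity (L.facO K t τ) L.scO L.wO L.Cw S.vol L.Λg (jlogOf L.Cl K) K) ∧
        0 ≤ L.Cw ∧ 1 ≤ L.Λg ∧ L.θ' ≤ L.Λg ∧
        -- (ii-m) the reference ledger's lattice identification
        (∀ K, (Pf K).d = d₀) ∧ (∀ K, (Pf K).L = L₀) ∧ (∀ K, (Pf K).K = Koff + K) ∧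
        (∀ K, (Fintype.card (Site (Pf K) (Pf K).K) : ℝ) = S.vol) ∧
        kappa₀ (4 * 2 ^ d₀) (2 * d₀) ≤ R.u3.κ ∧
        (∀ K, ∀ X ∈ L.All K,
          (cells K (R.u3.C.scale X + Koff) X).Nonempty ∧ TFaceConnected (cells K (R.u3.C.scale X + Koff) X)) ∧
        (∀ K j, Set.InjOn (cells K j) ↑((L.All K).filter fun X => R.u3.C.scale X + Koff = j)) ∧
        (∀ K, ∀ X ∈ L.All K, torusTreeLen (cells K (R.u3.C.scale X + Koff) X) ≤ R.u3.C.d X) ∧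
        -- (iii) [III] Theorem 2 (2.43) AS PRINTED with window letters
        B14.Thm2Printed H033 fam Lb βw κ₁ ∧ βw < 1 ∧ 0 < βw ∧ 1 < Lb ∧ 1 ≤ Gv ∧ 0 ≤ Cl ∧
        -- (iv) the positional-count half of N14's pinned pair at a rate `≤ R.ne1.Λ`
        (∀ p K, (R.ne1.𝒯.B p K).PositionalCount fun j k => N₀ * Λ₀ ^ (k - j)) ∧ 0 ≤ N₀ ∧ 0 ≤ Λ₀ ∧ Λ₀ ≤ R.ne1.Λ ∧
        -- (ii-v-A) run A's vacuum slices ↔ printed E-terms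
        (∀ K t, |t| ≤ S.l₀ → ∀ τ ∈ S.T K \ S.Bad K t, ∀ v ∈ Rd.dom, ∀ j ≤ K, ∃ (i : I) (w : (fam i).Ω) (j' : ℕ),
          (fam i).flow.SatisfiesRG (fam i).K ∧ H033 (fam i).flow (fam i).K ∧ 1 ≤ j' ∧ j' ≤ (fam i).K ∧
          (fam i).K - j' = K - j ∧ (fam i).K ≤ K + K₁ ∧
          (∀ n, 0 ≤ (fam i).gammaVol n w) ∧ (fam i).gammaVol (fam i).K w ≤ S.vol ∧
          (∀ n, n < (fam i).K → n < jlogOf Cl (fam i).K → (fam i).gammaVol n w = 0) ∧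
          (∀ n, n < (fam i).K → jlogOf Cl (fam i).K ≤ n → (fam i).gammaVol n w ≤ S.vol * Gv ^ ((fam i).K - n)) ∧
          |∑ X ∈ (L.fac K t τ).filter (fun X => ¬ dressed X) with R.u3.C.scale X = j,
              (R.u3.EA (g K) (uA K v) X - R.u3.EA (g K) L.oneA X)| ≤ |(fam i).eTerm j' (fam i).K w|) ∧
        -- (ii-v-B) run B's vacuum slices ↔ printed E-terms
        (∀ K t, |t| ≤ S.l₀ → ∀ τ ∈ S.T K \ S.Bad K t, ∀ v ∈ Rd.dom, ∀ j ≤ K, ∃ (i : I) (w : (fam i).Ω) (j' : ℕ),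
          (fam i).flow.SatisfiesRG (fam i).K ∧ H033 (fam i).flow (fam i).K ∧ 1 ≤ j' ∧ j' ≤ (fam i).K ∧
          (fam i).K - j' = K - j ∧ (fam i).K ≤ K + K₁ ∧
          (∀ n, 0 ≤ (fam i).gammaVol n w) ∧ (fam i).gammaVol (fam i).K w ≤ S.vol ∧
          (∀ n, n < (fam i).K → n < jlogOf Cl (fam i).K → (fam i).gammaVol n w = 0) ∧
          (∀ n, n < (fam i).K → jlogOf Cl (fam i).K ≤ n → (fam i).gammaVol n w ≤ S.vol * Gv ^ ((fam i).K - n)) ∧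
          |∑ X ∈ (L.fac K t τ).filter (fun X => ¬ dressed X) with R.u3.C.scale X = j,
              (EB (fun i => g (K + 1) (i + 1)) (uB K v) X - EB (fun i => g (K + 1) (i + 1)) L.oneB X)|
            ≤ |(fam i).eTerm j' (fam i).K w|) ∧
        -- (ii-d) the dressed sub-ledger ↔ N14's bookings on `R.ne1.𝒯`
        (∀ K t, |t| ≤ S.l₀ → ∀ τ ∈ S.T K \ S.Bad K t, ∀ v ∈ Rd.dom,
          ∃ (pA : R.ne1.P) (βA : R.u3.C.Dom → (R.ne1.𝒯.B pA K).Birth) (Q : Finset (R.ne1.𝒯.B pA K).Cube) (pB : R.ne1.P)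
            (KB : ℕ) (βB : R.u3.C.Dom → (R.ne1.𝒯.B pB KB).Birth),
          (∀ X ∈ (L.fac K t τ).filter (fun X => dressed X), (R.ne1.𝒯.B pA K).birthScale (βA X) = R.u3.C.scale X) ∧
          (∀ j, Set.InjOn βA ↑(((L.fac K t τ).filter (fun X => dressed X)).filter fun X => R.u3.C.scale X = j)) ∧
          (∀ c ∈ Q, (R.ne1.𝒯.B pA K).cubeScale c = K) ∧ ((Q.card : ℝ) ≤ S.vol) ∧
          (∀ X ∈ (L.fac K t τ).filter (fun X => dressed X), ∃ c ∈ Q, βA X ∈ (R.ne1.𝒯.B pA K).feltAt c) ∧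
          (∀ X ∈ (L.fac K t τ).filter (fun X => dressed X), KB - (R.ne1.𝒯.B pB KB).birthScale (βB X) = K - R.u3.C.scale X) ∧
          (∀ X ∈ (L.fac K t τ).filter (fun X => dressed X),
            |R.u3.EA (g K) (uA K v) X - R.u3.EA (g K) L.oneA X| ≤ (R.ne1.𝒯.B pA K).size (βA X) K) ∧
          (∀ X ∈ (L.fac K t τ).filter (fun X => dressed X),
            |EB (fun i => g (K + 1) (i + 1)) (uB K v) X - EB (fun i => g (K + 1) (i + 1)) L.oneB X|
              ≤ (R.ne1.𝒯.B pB KB).size (βB X) KB)) ∧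
        -- (v′-16) N16 BY NAME: THE END's regime letters of `R.ne3`, N07's interface, the selection, NE7 route-#1's side letters, the
        -- reading map, the action-reading identification, the offset, the gauge-domination convention
        R.ne3.g = gradConst 4 c' ∧ 2 ≤ R.ne3.L ∧ 1 ≤ R.ne3.Nper ∧ 0 ≤ R.ne3.b ∧ 0 ≤ c' ∧ R.ne3.b ≤ t ∧ c' ≤ t ∧ 0 ≤ R.ne3.C ∧
        (2 : ℝ) ^ 91 * (R.ne3.L : ℝ) ^ 17 * t ≤ 1 ∧ (2 : ℝ) ^ 76 * (R.ne3.L : ℝ) ^ 12 * t ≤ R.ne3.ε ∧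
        16 * B7Prop2Explicit.C0 4 * R.ne3.ε ≤ 3 ∧ 1024 * (4 + 1) * (4 + 4) * (R.ne3.L : ℝ) ^ 2 * R.ne3.ε ≤ 1 ∧
        ε₁ ≤ 1 / 4 ∧ ε₁ ≤ R.ne3.b ∧ 4 * ε₁ ≤ c' ∧ R.ne3.dom ⊆ sfClass 4 R.ne3.L R.ne3.Nper ε₁ 0 ∧
        LeafH3sup 4 R.ne3.L R.ne3.Nper R.ne3.ε R.ne3.b c' R.ne3.dom ∧
        (∀ V ∈ R.ne3.dom, ∀ k : ℕ, IsMinimiser 4 (sfClass 4 R.ne3.L R.ne3.Nper R.ne3.ε) R.ne3.L R.ne3.Nper k V (sel k V)) ∧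
        (∀ V ∈ R.ne3.dom, ∀ k : ℕ, RegularSup 4 R.ne3.L R.ne3.Nper R.ne3.b c' k (sel k V)) ∧
        0 < θ ∧ θ ^ 6 = ((R.ne3.L : ℝ))⁻¹ ∧ 0 < R.ne3.Λ₂' ∧ 0 < γ₃ ∧
        R.ne3.C * (wallConst 4 R.ne3.L * (R.ne3.Nper : ℝ) ^ 2 *
          (Real.sqrt (gradConst 4 c') * dualC2 4 R.ne3.L + 2 * R.ne3.b ^ 2 * dualC1 4 R.ne3.L)) ≤ γ₃ ^ 3 ∧
        0 < l₁ ∧ R.ne3.Λ₁ ≤ l₁ ^ 3 ∧ γ₃ * θ ^ 2 ≤ l₁ * R.ne3.Nper ∧ θ ^ ((3 : ℝ) * β - 2) ≤ θ₃ ∧ θ₃ < 1 ∧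
        (∀ v ∈ Rd.dom, rd v ∈ R.ne3.dom) ∧
        (∀ k, ∀ v ∈ Rd.dom, Rd.act k v = minAct 4 (sfClass 4 R.ne3.L R.ne3.Nper R.ne3.ε) R.ne3.L R.ne3.Nper k (rd v)) ∧
        (R.ne3.Nper : ℝ) ^ 4 ≤ Rd.vol ∧ 1 ≤ k₀ ∧
        (∀ K : ℕ, ∀ v ∈ Rd.dom, ∀ (u : B7Prop1Explicit.Site 4 → (Matrix (Fin N) (Fin N) ℂ)ˣ)
          (Z : B7Prop1Explicit.Site 4 → Fin 4 → Matrix (Fin N) (Fin N) ℂ) (M : ℝ),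
          IsUnitarySite u → IsPeriodicSite u ((R.ne3.Nper * R.ne3.L ^ (k₀ + K) : ℕ) : ℤ) → T4AveragingDeficitWall.IsSkewDir Z →
          IsPeriodicDir Z ((R.ne3.Nper * R.ne3.L ^ (k₀ + K) : ℕ) : ℤ) →
          B7Prop1Explicit.gaugeAct u (sel (k₀ + K) (rd v)) =
            T4AveragingDeficitWall.vary (B7Prop2Explicit.rescale R.ne3.L (B7Prop1Explicit.bavg R.ne3.L (sel (k₀ + K + 1) (rd v)))) Z 1 →
          (∀ (x : B7Prop1Explicit.Site 4) (κ : Fin 4), (R.ne3.L : ℝ) ^ (k₀ + K) * ‖Z x κ‖ ≤ M) →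
          (∀ (x : B7Prop1Explicit.Site 4) (μ κ : Fin 4), ((R.ne3.L : ℝ) ^ (k₀ + K)) ^ 2 *
              ‖T4AveragingDeficitWall.Ad (B7Prop2Explicit.rescale R.ne3.L (B7Prop1Explicit.bavg R.ne3.L (sel (k₀ + K + 1) (rd v)))
                  (x + B7Prop1Explicit.e κ) μ) (Z (x + B7Prop1Explicit.e μ) κ) - Z x κ‖ ≤ M) →
          R.u3.C.gauge (uA K v) (R.u3.C.transport (uB K v)) ≤ M) ∧
        -- letter signs
        0 ≤ R.u3.θ ∧ 0 ≤ R.u3.C₅ ∧ 0 ≤ R.u3.ω ∧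
        -- (v′-17) N17 BY NAME: the (0.20)-run identification, the infrared pin, (D4), the β-window READ ALONG THE RUNS `g K`, the smallness window, rates
        (∀ K, RGEqH K D.βfun (g K)) ∧ (∀ K, g K K = gIR) ∧ ReadOutAt D R.u3 ∧ 0 < bβ ∧
        (∀ K m, k₀β ≤ m → m < K → bβ ≤ D.βfun m (prefixOf (g K) m)) ∧
        0 < γt ∧ γt ≤ R.u3.γ ∧
        R.u3.cr * R.u3.C₉ * R.u3.ω * (((k₀β : ℝ) + 1) * γt ^ 3 + 2 * γt / bβ) ≤ (1 - R.u3.ρ) / 2 ∧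
        0 < R.u3.ρ ∧ R.u3.ρ < 1 ∧ 0 < R.u3.γ ∧ R.u3.ρ ≤ θc ∧
        -- the box AT THE RUNS' OWN RADIUS `γt ≤ R.u3.γ`
        (∀ K i, i ≤ K → 0 < g K i ∧ g K i ≤ γt) ∧
        -- the bracket (T) IN THE TUBE CURRENCY (`N19LipBracketTube.lipBracket_at_rateCarriers_of_pairDisc`'s inputs): the (1.18) real
        -- bound; the pair-disc shape at the printed tube radius κ₁·α(C₁, q₁, s_j) ((2.27)(ii)(iv) through the (1.13)∕(2.39) tube — SHAPE,
        -- NODE O); signs; the window's smallness; the UPPER running of the tables ((2.6) ∕ (0.31) upper half, β-side conditional, DISPLAYED)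
        DecayBound R.u3.EA R.u3.W E₀T R.u3.κ ∧
        (∀ s ∈ R.u3.W, ∀ (X : R.u3.C.Dom) (U U' : R.u3.C.BgA),
          R.u3.C.gauge U U' < κ₁T * B14.alphaJ C₁T q₁ (s (R.u3.C.scale X)) →
          ∃ f : ℂ → ℂ, DifferentiableOn ℂ f (Metric.ball (0 : ℂ) (κ₁T * B14.alphaJ C₁T q₁ (s (R.u3.C.scale X)))) ∧
            f 0 = (R.u3.EA s U X : ℂ) ∧ f (R.u3.C.gauge U U' : ℂ) = (R.u3.EA s U' X : ℂ) ∧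
            ∀ z ∈ Metric.ball (0 : ℂ) (κ₁T * B14.alphaJ C₁T q₁ (s (R.u3.C.scale X))),
              ‖f z‖ ≤ E₀T * Real.exp (-(R.u3.κ * R.u3.C.d X))) ∧
        0 ≤ E₀T ∧ 0 < κ₁T ∧ 0 < C₁T ∧ (∀ s ∈ R.u3.W, ∀ j, 0 < s j ∧ s j ^ 2 ≤ Real.exp (-1)) ∧
        (∀ K j, j ≤ K → 1 / g K j ^ 2 ≤ 1 / gIR ^ 2 + β'T * ((K : ℝ) - j)) ∧ 0 ≤ β'T ∧
        -- window memberships, selector compatibility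
        (∀ K, g K ∈ R.u3.W) ∧ (∀ K, (fun i => g (K + 1) (i + 1)) ∈ R.u3.W) ∧
        (∀ s ∈ R.u3.W, 0 < bsel s ∧ bsel s ≤ R.u3.γ)) :
    ∀ (F : T4Continuum.T4Family) (D : YMDAG.UVSplit.Datum F N) (g₀ : ℕ → ℝ) (os : List (T4Continuum.ULoop F))
      (S : SpineCarriers) (R : RateCarriers N), PRec F D g₀ os S R → RatesHolderAt D R β → letI := S.dec
      ∃ δ : ℕ → ℝ, NE7.Core S.l₀ S.vol S.T S.Bad (fun K t τ => S.A K t τ - S.shA K t τ)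
        (fun K t τ => S.B K t τ - S.shB K t τ) δ ∧ Summable δ := by
  intro F D g₀ os S R hSR hrates
  letI := S.dec
  -- destructure the link reading IN STAGES (one flat 113-component `obtain` is quadratic in the pattern count: ≈ 14 min on the farm)
  obtain ⟨_, F', ι', X', _, L, Rd, bsel, EB, θc, θ₃, g, uA, uB, hrest⟩ := hlink F D g₀ os S R hSR
  obtain ⟨Pf, d₀, L₀, Koff, cells, H033, I, fam, Lb, βw, κ₁, Gv, Cl, K₁, Λ₀, N₀, dressed, _, hrest⟩ := hrest
  obtain ⟨c', t, ε₁, θ, γ₃, l₁, sel, rd, k₀, gIR, bβ, γt, k₀β, E₀T, κ₁T, C₁T, β'T, q₁, hrest⟩ := hrest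
  obtain ⟨hEB, hL, hvol, homult, hCw, hΛg, hθΛ, hPd, hPL, hPK, hcard, hκ₀, hdom, hinj, hlen, hrest⟩ := hrest
  obtain ⟨h11, hβw1, hβw0, hLb, hGv, hCl, hcount, hN₀, hΛ₀, hle, hidA, hidB, hidD, hrest⟩ := hrest
  -- (v′-16)
  obtain ⟨hg3, hL2, hNper, hb, hc', hbt, hct, hC3, hsmall3, hεt, hε1, hε2, hε₁, hε₁b, hε₁c, hdom3, hH3, hsel, hreg, hrest⟩ := hrest
  obtain ⟨hθ0, hθ6, hΛ₂', hγ₃, hγ3, hl₁, hΛl₁, hfit, hθ₃θ, hθ₃1, hrd, hact, hvol3, hk₀, hdomC1, hrest⟩ := hrest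
  -- signs, (v′-17), the box
  obtain ⟨hθ, hC₅, hω, hrun, hpin, hD4, hbβ, hlo, hγt0, hγtle, hsmallβ, hρ0, hρ1, -, hρθc, hboxt, hrest⟩ := hrest
  -- the box at the carriers' radius from the box at the runs' own radius
  have hbox : ∀ K i, i ≤ K → 0 < g K i ∧ g K i ≤ R.u3.γ := fun K i hi => ⟨(hboxt K i hi).1, (hboxt K i hi).2.trans hγtle⟩
  -- (T) in the tube currency, windows, selector
  obtain ⟨hdecT, hdiscT, hE₀T, hκ₁T, hC₁T, hWsm, hup, hβ'T, hgA, hgB, hbsel⟩ := hrest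
  -- the bracket (T) PRODUCED from the tube inputs (`N19LipBracketTube` §4); the infrared coupling is positive by the box and the pin
  have hgIR : 0 < gIR := by
    have h := (hbox 0 0 le_rfl).1
    rwa [hpin 0] at h
  obtain ⟨CU, Pg, hU, hG, hPg⟩ :=
    lipBracket_at_rateCarriers_of_pairDisc R hdecT hdiscT hE₀T hκ₁T hC₁T hWsm hgA hup hgIR hβ'T
  haveI : Nonempty (Fin N) := ⟨⟨0, Nat.pos_of_ne_zero (NeZero.ne N)⟩⟩
  -- N14 · N18 · N22 from `RatesHolderAt D R β` by name (same conjunct positions as v9's `RatesAt D R`)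
  have h14 : DressedStabilityStrict R.ne1.𝒯 R.ne1.Λ := dressedStabilityStrict_of_n14At hrates.1
  have h18 : NE5 R.u3.EA EB R.u3.W R.u3.κ R.u3.θ R.u3.C₅ := by
    rw [hEB]; exact ne5_of_n18At R.u3 hrates.2.2.2.2.1 bsel hbsel
  have h22 : NE9 R.u3.EA R.u3.W R.u3.κ R.u3.Λ ∧ T4OutputRate.FadingMemory R.u3.C₉ R.u3.ω R.u3.Λ := hrates.2.2.2.2.2
  -- N16 from `RatesHolderAt D R β` by name: the β-root at the bundle (`N16HolderAt R.ne3 β`, `Iff.rfl` to `CovRootHolder … β R.ne3.dom`), read with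
  -- `R.ne3.g = gradConst 4 c′`, through dag-n16-c's Hölder liaison (the ONE changed call)
  have h16 : CovRootHolder 4 (sfClass 4 R.ne3.L R.ne3.Nper R.ne3.ε) R.ne3.L R.ne3.Nper R.ne3.b
      (gradConst 4 c') R.ne3.C R.ne3.Λ₁ R.ne3.Λ₂' β R.ne3.dom := by
    rw [← hg3]; exact hrates.2.2.1
  obtain ⟨C₃, loc, hC₃, h16', hgd⟩ :=
    ne3LiaisonC1_of_covRootHolder (n := Fin N) hL2 hNper hβ1 hb hc' hbt hct hC3 hsmall3 hεt hε1 hε2 hε₁ hε₁b hε₁c hdom3 h16 hH3 sel hsel hreg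
      hθ0 hθ6 hΛ₂' hγ₃ hγ3 hl₁ hΛl₁ hfit hθ₃θ hθ₃1 Rd rd hrd hact hvol3 uA uB hk₀ hdomC1
  -- N17 from `RatesHolderAt D R β` by name: node U2's output on the tables, companions from (D4) · N18 · N22, worsened to the record's rate `θc`
  have hc17 : 0 ≤ R.u3.cr * R.u3.C₅ * R.u3.θ :=
    (Summit.QuantumFields.YangMills.BalabanUVNodes.N19InEdgesAtRecord.histCompanions_of_readOutAt D hD4 hrates.2.2.2.2.1 hrates.2.2.2.2.2).2.2.1
  have hCd : 0 ≤ 2 * (R.u3.cr * R.u3.C₅ * R.u3.θ) / (1 - R.u3.ρ) := div_nonneg (mul_nonneg zero_le_two hc17) (by linarith)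
  have hinj17 : InjectedRate (2 * (R.u3.cr * R.u3.C₅ * R.u3.θ) / (1 - R.u3.ρ)) 0 θc
      (fun K j => T4CouplingMatching.disc (g K) (g (K + 1)) j) :=
    (injectedRate_of_n17At_readOutAt_along_radius D hrates.2.2.2.1 hD4 hrates.2.2.2.2.1 hrates.2.2.2.2.2 hγt0 hγtle hbβ hρ0 hρ1 hrun hboxt hpin hlo
      hsmallβ).mono_rate hCd hρ0.le hρθc
  have hθc : 0 ≤ θc := hρ0.le.trans hρθc
  -- knit v6 on the re-localised readings family (the ledger predicate transfers: `ledgerAtSync_withLoc`)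
  exact core_summable_of_ledgerAtSync_multByName (R := (⟨Rd.dom, Rd.act, loc, Rd.vol, Rd.vol_nonneg⟩ : Readings ι' Unit))
    (fun Sz E₀ m a Cw Λg hSz hE₀ ha0 ha1 hSle hm hom hΛ1 hθΛ' =>
      ledgerAtSync_withLoc (hL Sz E₀ m a Cw Λg hSz hE₀ ha0 ha1 hSle hm hom hΛ1 hθΛ') loc)
    hvol homult hCw hΛg hθΛ Pf hPd hPL hPK hcard hκ₀ cells hdom hinj hlen H033 fam h11 hβw1 hβw0 hLb hGv hCl K₁ ⟨h14, hcount⟩ hN₀ hΛ₀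
    hle dressed hidA hidB hidD h16' hC₃ hgd h18 hθ hC₅ h22 hω hinj17 hCd hθc hbox hU hG hPg hgA hgB

end Edge

end Summit.QuantumFields.YangMills.BalabanUVNodes.N19RateEdgeHolderAlong

end
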